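/-
Copyright: cell `pub-ymgap` (HUMAN RULING D-0062), Track A of `YM-PLAN.md`, DAG node N20 (= NE7b); R134 acceleration seat
`pub-ymgap-dag-n20-c` (strategy s1, generation 3), module 10b.  Released under the licence of the surrounding project.
-/
import Summits.QuantumFields.YangMills.Theorems.BalabanUVNodesN20LCSRestrictedDoublingOneSite
import HarnessLib

/-!
# YM-DAG node N20 (= NE7b), strategy s1, module 10b: the RESTRICTED holonomy-conditioned Gaussian LOWER BOUND of the small-field-restricted
# torus partition function — the host's `twist_lower_master` ∕ `torus_lower_axisHolonomy` re-run with the restriction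
# `∏_p 𝟙[N − Re tr r(U_p) ≤ ε]`, at NO extra cost beyond a factor `2` once `bε ≥ c`

Track A of `YM-PLAN.md` (cell `pub-ymgap`, HUMAN RULING D-0062), node **N20** = spine estimate NE7b (`T4WeightBudget.RelWeightBound` — the
cell `pub-balaban`'s OWN estimate, NOT PRINTED in [Bałaban 1983–89], NOT PROVED).  Seat `pub-ymgap-dag-n20-c` (R134, s1), module 10 in three
files (10a `…N20LCSRestrictedDoublingOneSite`, 10b `…N20LCSRestrictedDoublingLower`, 10c `…N20LCSRestrictedDoubling`; modules 8∕9: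
`…Theorems.BalabanUVNodesN20LCSRestrictedRP{,CauchySchwarz}` — reflection positivity and reflection Cauchy–Schwarz of the restricted level-0
state).  Kernel theorems only: 0 `def`, 0 `sorry`, standard axioms; COUNT-NEUTRAL; `--supports` the K3′ item `SpineGivenEndpointR12`
(stmt-QuantumFields-19908) as a helper.  Nothing of Bałaban's is asserted: the objects are the host tree's (`partitionFunction`, `wilsonAction`,
`WilsonRP.plaqRe`, `haarProbability`, the comb gauge `combEdges`∕`combHolonomy`, the hyperplane twist of `TwistLower`), read BY NAME; the
small-field-RESTRICTED partition function `Z_{L,ε}(b) := ∫ e^{−b S(U)}·∏_p 𝟙[N − Re tr r(U_p) ≤ ε] dHaar^{⊗E}(U)` is written INLINE (no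
definition is introduced).

WHY (the three files).  «LCS-j» (`Spine/NE7b/LocalConditionalStability.LocCondStability`) from level 1 on asks local exponential plaquette
moments in the HISTORY TERM's own state, i.e. for the Wilson weight RESTRICTED by the earlier steps' small-field characteristic functions
(modules 1∕6∕7; the seat's `N20-S1-TRIAGE.md` §1, residual (ii)).  The unrestricted rung 0 (`Spine/NE7b/LocalPlaquetteExpMoments`) is
chessboard + convexity + the host's UNIFORM TORUS DOUBLING `Z_L(b∕2) ≤ e^{AL⁴}Z_L(b)` (`TorusGauge.uniformDoubling_all`); for the restricted
state the chessboard inputs are modules 8∕9 and the β-uniform global input is the RESTRICTED doubling `Z_{L,ε}(b∕2) ≤ e^{AL⁴}Z_{L,ε}(b)`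
(`bε ≥ c`) of file 10c.  No monotonicity in the restriction is available in the tree (no FKG for gauge theories), so the β-uniform comparison
must come from the Gaussian localisation itself: the host's lower-bound region (comb gauge, inner links in `δ = b^{−1∕2}`-balls around the
hyperplane twist of the four axis holonomies) lies INSIDE the `ε`-small region as soon as the axis holonomies' six commutator energies are
`≤ ε' = (ε − 16∕b)∕2`, which costs at most a factor `2` of the one-site function once `bε ≥ c(r)`.

WHAT IS PROVED HERE ([folklore]: Fubini–Tonelli marginals `MeasureTheory.lmarginal`; the host's comb gauge and twist algebra BY NAME):
* §3 ★ **`restricted_twist_lower_master`** — `e^{−96bδ²L⁴}·Haar{‖r g − 1‖ ≤ δ}^{3L⁴−3}·Z_{1,ε'}(2L²b) ≤ Z_{L,ε}(b)` whenever `2ε' + 16δ² ≤ ε`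
  (the host's `TorusGauge.twist_lower_master` verbatim, with ONE addition: on the `δ`-balls around the hyperplane twist every plaquette energy
  is `≤ 2·(twist plaquette energy) + 16δ²` (`plaqEnergy_le_two_mul_add_of_near`) and the twist's plaquette energies are one-site commutator
  energies or `0` (`plaqEnergy_twist_le`), so when the axis quadruple is `ε'`-small the whole ball is `ε`-small and the restriction is not felt;
  otherwise the comparison function vanishes).
* §5 ★ **`restricted_torus_lower_axisHolonomy`** — there are `C₁ > 0`, `A` (`= 96 + log 2`), `c > 0` with
  `e^{−AL⁴}·(C₁ b^{−D∕2})^{3L⁴−3}·Z₁(2L²b) ≤ Z_{L,ε}(b)` for all `L ≥ 2`, `b ≥ 1`, `bε ≥ c` (`D = dimE r.ρ`): the SAME lower bound as the host's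
  unrestricted `torus_lower_axisHolonomy` up to the factor `2` of file 10a's one-site concentration (at temperature `2L²b`:
  `2L²b·ε' = L²(bε − 16) ≥ bε − 16 ≥ c(r)`), absorbed in `A`.
(The doubling itself and the restricted exponential moment of the action are file 10c.)

HONEST FRAMING.  Host currency (bare Wilson weight on `GaugeConfig 4 L G`, any compact second-countable `G` with a faithful unitary
`LatticeRep`), ONE threshold `ε` on ALL plaquettes, `bε ≥ c(r)` (Bałaban's small-field thresholds have `βε_k → ∞`, so the hypothesis is the
regime; for `bε < c` nothing is claimed).  NOT here: the site∕cube chessboard ITERATION for the restricted state (residual (ii)(b)), the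
record-level reading (module 7's dictionary transports it), levels `≥ 1` of LCS, residual (i) (domination letter for `avOfRecord`, seat
n20-d), (iv) (A1c).  NE7b NOT PRINTED ∕ NOT PROVED; (α)-instance 0∕1; N20 NOT discharged; typed 28∕28, discharged count untouched; one finite
four-torus at fixed `ε` — NOT ℝ⁴, NOT infinite volume, NOT OS axioms, NOT a mass gap, NOT Clay.
-/

set_option autoImplicit false

noncomputable section

open scoped Matrix.Norms.Frobenius ENNReal
open MeasureTheory
open Literature.MathematicalPhysics.QuantumFieldTheory
open Summit.QuantumFields.YangMills.Theorems.FreeEnergyLogCoefficient (dimE exists_haar_gball_ge WeakCoupling.sub_re_trace_eq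
  haar_setOf_norm_sub_le continuous_norm_rho_sub)
open Summit.QuantumFields.YangMills.Theorems.FemtoCurvatureTwoPoint.DoublingOfRV (card_plaquette)
open Summit.QuantumFields.YangMills.Theorems.FemtoCurvatureTwoPoint.PlaquetteVariance (partitionFunction_toReal_pos)
open Summit.QuantumFields.YangMills.Theorems.FemtoCurvatureTwoPointC (OneSite.partitionFunction_eq_lintegral'
  OneSite.plaquetteHolonomy_eq_commutator OneSite.wilsonAction_eq_commutatorCost oneSite_partitionFunction_doubling)
open Summit.QuantumFields.YangMills.Theorems.FemtoCurvatureTwoPointC.TorusGauge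

namespace Summit.QuantumFields.YangMills.BalabanUVNodes.N20LCSRestrictedDoubling

/-! ## §3 The RESTRICTED holonomy-conditioned Gaussian lower bound (the host's `twist_lower_master` re-run with the restriction) -/

section Lower

variable {G : Type} [Group G] [TopologicalSpace G] [IsTopologicalGroup G] [CompactSpace G] [MeasurableSpace G]
  [BorelSpace G] [SecondCountableTopology G]

/-- **RESTRICTED HOLONOMY-CONDITIONED GAUSSIAN LOWER BOUND, master form.**  For every four-torus `(ℤ∕L)⁴`, `b ≥ 0`, `δ ≥ 0` and
thresholds with `2ε' + 16δ² ≤ ε`: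
`e^{−96 b δ² L⁴} · Haar{‖r g − 1‖ ≤ δ}^{3L⁴−3} · Z_{1,ε'}(2L²b) ≤ Z_{L,ε}(b)`,
where `Z_{L,ε}(b) = ∫ e^{−bS}·∏_p 𝟙[N − Re tr r(U_p) ≤ ε] dHaar^{⊗E}` is the small-field-RESTRICTED partition function of the torus and
`Z_{1,ε'}` the restricted ONE-SITE function (the torus `(ℤ∕1)⁴`: the commutator weight of the four axis holonomies with its six
commutator energies restricted to `≤ ε'`).  The host's `TorusGauge.twist_lower_master` verbatim — comb gauge
(`restrictedPF_eq_lintegral_combGauge`), the `3L⁴ − 3` inner links integrated out over the `δ`-balls around the hyperplane twist `Ū(a)` of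
the axis quadruple `a`, the law of `a` = product Haar (`pi_map_proj_eq_pi`) — with ONE addition: on those balls EVERY plaquette energy is
`≤ 2·(N − Re tr r(Ū(a)_p)) + 16δ²` (`plaqEnergy_le_two_mul_add_of_near`) and the twist's plaquette energies are one-site commutator energies
or `0` (`plaqEnergy_twist_le`), so when the axis quadruple is `ε'`-small the whole ball lies inside the `ε`-small region and the restriction
costs nothing; when it is not, the comparison function vanishes. [folklore] -/
theorem restricted_twist_lower_master (r : LatticeRep G) (L : ℕ) [NeZero L] {b δ ε ε' : ℝ} (hb : 0 ≤ b)
    (hδ : 0 ≤ δ) (hε : 2 * ε' + 16 * δ ^ 2 ≤ ε) :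
    ENNReal.ofReal (Real.exp (-(b * (96 * δ ^ 2 * (L : ℝ) ^ 4)))) *
        haarProbability G {g : G | ‖r.ρ g - 1‖ ≤ δ} ^ (3 * L ^ 4 - 3) *
        ∫⁻ V : GaugeConfig 4 1 G, ENNReal.ofReal (Real.exp (-(2 * (L : ℝ) ^ 2 * b) * wilsonAction r.ρ V) *
            ∏ q : Plaquette 4 1, (if (r.N : ℝ) - WilsonRP.plaqRe r.ρ V q ≤ ε' then (1 : ℝ) else 0))
          ∂(Measure.pi fun _ : Edge 4 1 => haarProbability G) ≤
      ∫⁻ U : GaugeConfig 4 L G, ENNReal.ofReal (Real.exp (-b * wilsonAction r.ρ U) *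
            ∏ p : Plaquette 4 L, (if (r.N : ℝ) - WilsonRP.plaqRe r.ρ U p ≤ ε then (1 : ℝ) else 0))
          ∂(Measure.pi fun _ : Edge 4 L => haarProbability G) := by
  classical
  -- the axis coordinates `J μ`, the projection `P` to a one-site configuration, the inner links `s`
  let J : Fin 4 → {e : Edge 4 L // e ∉ combEdges L} := fun μ =>
    ⟨((Pi.single μ (((L - 1 : ℕ) : ZMod L)) : Site 4 L), μ), TwistLower.axis_notMem_combEdges μ⟩
  let P : ({e : Edge 4 L // e ∉ combEdges L} → G) → GaugeConfig 4 1 G := fun W e' => W (J e'.2)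
  let s : Finset {e : Edge 4 L // e ∉ combEdges L} := Finset.univ.filter fun i =>
    ∀ μ : Fin 4, i.1 ≠ ((Pi.single μ (((L - 1 : ℕ) : ZMod L)) : Site 4 L), μ)
  have hJs : ∀ μ, J μ ∉ s := fun μ h => by
    have h' := (Finset.mem_filter.1 h).2 μ
    exact h' rfl
  have hs_card : s.card = 3 * L ^ 4 - 3 := TwistLower.card_inner
  -- the restricted weights: on the torus (`F`, through the comb-gauge extension `extW`) and on one site (`E`)
  let D : GaugeConfig 4 L G → ℝ := fun U =>
    ∏ p : Plaquette 4 L, (if (r.N : ℝ) - WilsonRP.plaqRe r.ρ U p ≤ ε then (1 : ℝ) else 0)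
  let D₁ : GaugeConfig 4 1 G → ℝ := fun V =>
    ∏ q : Plaquette 4 1, (if (r.N : ℝ) - WilsonRP.plaqRe r.ρ V q ≤ ε' then (1 : ℝ) else 0)
  let extW : ({e : Edge 4 L // e ∉ combEdges L} → G) → GaugeConfig 4 L G := fun W e =>
    if h : e ∈ combEdges L then (1 : G) else W ⟨e, h⟩
  let F : ({e : Edge 4 L // e ∉ combEdges L} → G) → ℝ≥0∞ := fun W =>
    ENNReal.ofReal (Real.exp (-b * wilsonAction r.ρ (extW W)) * D (extW W))
  let K : ℝ≥0∞ := ENNReal.ofReal (Real.exp (-(b * (96 * δ ^ 2 * (L : ℝ) ^ 4)))) *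
    haarProbability G {g : G | ‖r.ρ g - 1‖ ≤ δ} ^ (3 * L ^ 4 - 3)
  let E : GaugeConfig 4 1 G → ℝ≥0∞ := fun V =>
    ENNReal.ofReal (Real.exp (-(2 * (L : ℝ) ^ 2 * b) * wilsonAction r.ρ V) * D₁ V)
  let Gf : ({e : Edge 4 L // e ∉ combEdges L} → G) → ℝ≥0∞ := fun W => K * E (P W)
  have hP : Measurable P := measurable_pi_lambda _ fun e' => measurable_pi_apply (J e'.2)
  have hF : Measurable F := (measurable_restrictedWeight r.ρ r.continuous b ε).comp measurable_combExtend
  have hE : Measurable E := measurable_restrictedWeight r.ρ r.continuous _ ε'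
  have hGf : Measurable Gf := (hE.comp hP).const_mul K
  -- (1) `∫ Gf = K · Z_{1,ε'}(2L²b)`: the law of the axis quadruple is product Haar
  have hlaw : (Measure.pi fun _ : {e : Edge 4 L // e ∉ combEdges L} => haarProbability G).map P =
      Measure.pi fun _ : Edge 4 1 => haarProbability G := by
    refine pi_map_proj_eq_pi (haarProbability G) (j := fun e' : Edge 4 1 => J e'.2) ?_
    intro e₁ e₂ h
    have h2 : e₁.2 = e₂.2 := congrArg (fun i : {e : Edge 4 L // e ∉ combEdges L} => i.1.2) h
    exact Prod.ext (Subsingleton.elim _ _) h2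
  have hint : ∫⁻ W, Gf W ∂(Measure.pi fun _ : {e : Edge 4 L // e ∉ combEdges L} => haarProbability G) =
      K * ∫⁻ V, E V ∂(Measure.pi fun _ : Edge 4 1 => haarProbability G) := by
    have hEP : Measurable fun W => E (P W) := hE.comp hP
    show ∫⁻ W, K * E (P W) ∂_ = _
    rw [lintegral_const_mul K hEP, ← hlaw, lintegral_map hE hP]
  -- (2) the one-step marginal comparison over the inner links
  have hcmp : ∫⋯∫⁻_s, Gf ∂(fun _ => haarProbability G) ≤ ∫⋯∫⁻_s, F ∂(fun _ => haarProbability G) := by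
    intro x
    -- `Gf` does not read the inner links
    have hPy : ∀ y : ↥s → G, P (Function.updateFinset x s y) = P x := fun y => by
      funext e'
      show Function.updateFinset x s y (J e'.2) = x (J e'.2)
      simp only [Function.updateFinset, dif_neg (hJs e'.2)]
    by_cases hD : ∀ q : Plaquette 4 1, (r.N : ℝ) - WilsonRP.plaqRe r.ρ (P x) q ≤ ε'
    · -- the axis quadruple is `ε'`-small: the ball around its twist lies inside the `ε`-small region
      have hD₁ : D₁ (P x) = 1 := Finset.prod_eq_one fun q _ => if_pos (hD q)
      -- the hyperplane twist of the axis quadruple of `x`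
      let Ubar : GaugeConfig 4 L G := fun e => if (e.1 e.2).val + 1 < L then 1 else x (J e.2)
      have hUbar : ∀ e : Edge 4 L, Ubar e = if (e.1 e.2).val + 1 < L then 1 else
          (fun μ => x (J μ)) e.2 := fun e => rfl
      have hSbar : wilsonAction r.ρ Ubar = (L : ℝ) ^ 2 * wilsonAction r.ρ (P x) := by
        rw [TwistLower.wilsonAction_twist r.ρ (fun μ => x (J μ)) hUbar,
          OneSite.wilsonAction_eq_commutatorCost]
      have hbar_small : ∀ p : Plaquette 4 L, (r.N : ℝ) - WilsonRP.plaqRe r.ρ Ubar p ≤ ε' :=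
        plaqEnergy_twist_le r.ρ r.mem_unitary (fun μ => x (J μ)) hUbar hD
      -- the product ball of the inner links around the twist, and its mass
      let B : Set (↥s → G) := Set.pi Set.univ fun i => {g : G | ‖r.ρ g - r.ρ (Ubar i.1.1)‖ ≤ δ}
      have hBm : MeasurableSet B := MeasurableSet.univ_pi fun i =>
        measurableSet_le (continuous_norm_rho_sub r.ρ r.continuous _).measurable measurable_const
      have hBvol : (Measure.pi fun _ : ↥s => haarProbability G) B =
          haarProbability G {g : G | ‖r.ρ g - 1‖ ≤ δ} ^ (3 * L ^ 4 - 3) := by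
        show (Measure.pi fun _ : ↥s => haarProbability G) (Set.pi Set.univ _) = _
        rw [Measure.pi_pi]
        simp only [haar_setOf_norm_sub_le r.ρ r.mem_unitary]
        rw [Finset.prod_const, Finset.card_univ, Fintype.card_coe, hs_card]
      -- the constant lower bound on the ball
      let c : ℝ≥0∞ := ENNReal.ofReal (Real.exp (-(b * (96 * δ ^ 2 * (L : ℝ) ^ 4)))) *
        ENNReal.ofReal (Real.exp (-(2 * (L : ℝ) ^ 2 * b) * wilsonAction r.ρ (P x)))
      have hlow : ∀ y ∈ B, c ≤ F (Function.updateFinset x s y) := by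
        intro y hy
        -- every link of the updated configuration is `δ`-close to the twist
        have hnear : ∀ e : Edge 4 L, ‖r.ρ (extW (Function.updateFinset x s y) e) - r.ρ (Ubar e)‖ ≤ δ := by
          intro e
          show ‖r.ρ ((fun e : Edge 4 L => if h : e ∈ combEdges L then (1 : G)
              else Function.updateFinset x s y ⟨e, h⟩) e) - r.ρ (Ubar e)‖ ≤ δ
          by_cases he : e ∈ combEdges L
          · simp only [dif_pos he]
            rw [TwistLower.twist_eq_one_of_mem_combEdges (fun μ => x (J μ)) (Ubar := Ubar) hUbar he,
              sub_self, norm_zero]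
            exact hδ
          · simp only [dif_neg he]
            by_cases hi : (⟨e, he⟩ : {e : Edge 4 L // e ∉ combEdges L}) ∈ s
            · have hyi := (Set.mem_univ_pi.1 hy) ⟨⟨e, he⟩, hi⟩
              simp only [Function.updateFinset, dif_pos hi]
              exact hyi
            · simp only [Function.updateFinset, dif_neg hi]
              have hax : ∃ μ : Fin 4, e = ((Pi.single μ (((L - 1 : ℕ) : ZMod L)) : Site 4 L), μ) := by
                by_contra hne
                exact hi (Finset.mem_filter.2 ⟨Finset.mem_univ _, fun μ hμ => hne ⟨μ, hμ⟩⟩)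
              obtain ⟨μ, rfl⟩ := hax
              rw [TwistLower.twist_axis (fun μ => x (J μ)) (Ubar := Ubar) hUbar μ, sub_self, norm_zero]
              exact hδ
        -- so `S ≤ 2L²f + 96δ²L⁴`, and EVERY plaquette is `ε`-small: the restriction is not felt
        have hS := TwistLower.wilsonAction_le_two_mul_add_of_near r.ρ r.mem_unitary hnear
        rw [hSbar, card_plaquette] at hS
        push_cast at hS
        have hDy : D (extW (Function.updateFinset x s y)) = 1 := by
          refine Finset.prod_eq_one fun p _ => if_pos ?_
          have h1 := plaqEnergy_le_two_mul_add_of_near r.ρ r.mem_unitary hnear p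
          linarith [hbar_small p, h1]
        show c ≤ ENNReal.ofReal (Real.exp (-b * wilsonAction r.ρ (extW (Function.updateFinset x s y))) *
          D (extW (Function.updateFinset x s y)))
        rw [hDy, mul_one]
        show ENNReal.ofReal _ * ENNReal.ofReal _ ≤ ENNReal.ofReal _
        rw [← ENNReal.ofReal_mul (Real.exp_pos _).le, ← Real.exp_add]
        refine ENNReal.ofReal_le_ofReal (Real.exp_le_exp.2 ?_)
        have h96 : 0 ≤ b * (96 * δ ^ 2 * (L : ℝ) ^ 4) := by positivity
        nlinarith [mul_le_mul_of_nonneg_left hS hb]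
      -- compare the two marginals at `x`
      calc (∫⋯∫⁻_s, Gf ∂(fun _ => haarProbability G)) x
          = ∫⁻ _y : ↥s → G, Gf x ∂(Measure.pi fun _ : ↥s => haarProbability G) := by
            refine lintegral_congr fun y => ?_
            show K * E (P (Function.updateFinset x s y)) = K * E (P x)
            rw [hPy]
        _ = c * haarProbability G {g : G | ‖r.ρ g - 1‖ ≤ δ} ^ (3 * L ^ 4 - 3) := by
            rw [lintegral_const, measure_univ, mul_one]
            show K * ENNReal.ofReal (Real.exp (-(2 * (L : ℝ) ^ 2 * b) * wilsonAction r.ρ (P x)) * D₁ (P x)) = c * _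
            rw [hD₁, mul_one]
            simp only [K, c]
            ring
        _ = ∫⁻ y, B.indicator (fun _ => c) y ∂(Measure.pi fun _ : ↥s => haarProbability G) := by
            rw [lintegral_indicator_const hBm, hBvol]
        _ ≤ ∫⁻ y, F (Function.updateFinset x s y) ∂(Measure.pi fun _ : ↥s => haarProbability G) := by
            refine lintegral_mono fun y => ?_
            by_cases hy : y ∈ B
            · rw [Set.indicator_of_mem hy]
              exact hlow y hy
            · rw [Set.indicator_of_notMem hy]
              exact bot_le
        _ = (∫⋯∫⁻_s, F ∂(fun _ => haarProbability G)) x := rfl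
    · -- the axis quadruple is NOT `ε'`-small: the comparison function vanishes at `x`
      obtain ⟨q, hq⟩ := not_forall.1 hD
      have hD₁ : D₁ (P x) = 0 := Finset.prod_eq_zero (Finset.mem_univ q) (if_neg hq)
      calc (∫⋯∫⁻_s, Gf ∂(fun _ => haarProbability G)) x
          = ∫⁻ _y : ↥s → G, (0 : ℝ≥0∞) ∂(Measure.pi fun _ : ↥s => haarProbability G) := by
            refine lintegral_congr fun y => ?_
            show K * E (P (Function.updateFinset x s y)) = 0
            rw [hPy]
            show K * ENNReal.ofReal (Real.exp (-(2 * (L : ℝ) ^ 2 * b) * wilsonAction r.ρ (P x)) * D₁ (P x)) = 0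
            rw [hD₁, mul_zero, ENNReal.ofReal_zero, mul_zero]
        _ = 0 := lintegral_zero
        _ ≤ _ := bot_le
  -- (3) assemble
  calc K * ∫⁻ V, E V ∂(Measure.pi fun _ : Edge 4 1 => haarProbability G)
      = ∫⁻ W, Gf W ∂(Measure.pi fun _ : {e : Edge 4 L // e ∉ combEdges L} => haarProbability G) := hint.symm
    _ ≤ ∫⁻ W, F W ∂(Measure.pi fun _ : {e : Edge 4 L // e ∉ combEdges L} => haarProbability G) :=
        lintegral_le_of_lmarginal_le s hGf hF hcmp
    _ = _ := (restrictedPF_eq_lintegral_combGauge r.ρ r.continuous b ε).symm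

end Lower

/-! ## §5 Assembly: the restricted lower bound at the Gaussian scale and the RESTRICTED UNIFORM DOUBLING -/

section Doubling

variable {G : Type} [Group G] [TopologicalSpace G] [IsTopologicalGroup G] [CompactSpace G] [MeasurableSpace G]
  [BorelSpace G] [SecondCountableTopology G]

/-- **RESTRICTED HOLONOMY-CONDITIONED GAUSSIAN LOWER BOUND** (the host's `torus_lower_axisHolonomy` for the restricted partition
function): there are `C₁ > 0`, `A` (`= 96 + log 2`) and `c > 0` such that for every four-torus `(ℤ∕L)⁴`, `L ≥ 2`, every `b ≥ 1` and every
threshold `ε` with `bε ≥ c`: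
`e^{−A L⁴}·(C₁ b^{−D∕2})^{3L⁴−3}·Z₁(2L²b) ≤ Z_{L,ε}(b)`, `D = dimE r.ρ` — the SAME lower bound as the unrestricted one up to the factor `2`
absorbed in `A`: §3 at the Gaussian scale `δ = b^{−1∕2}` with `ε' = (ε − 16∕b)∕2`, the small-ball bound `Haar{‖r g − 1‖ ≤ δ} ≥ C₁δ^D`
(`exists_haar_gball_ge`) and the one-site concentration of §4 at temperature `2L²b` (`2L²b·ε' = L²(bε − 16) ≥ bε − 16 ≥ c(r)`). [folklore] -/
theorem restricted_torus_lower_axisHolonomy (r : LatticeRep G) :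
    ∃ C₁ A c : ℝ, 0 < C₁ ∧ 0 < c ∧ ∀ (L : ℕ) [NeZero L] (b ε : ℝ), 2 ≤ L → 1 ≤ b → c ≤ b * ε →
      Real.exp (-(A * (L : ℝ) ^ 4)) * (C₁ * b ^ (-((dimE r.ρ : ℝ) / 2))) ^ (3 * L ^ 4 - 3) *
          (partitionFunction (d := 4) (L := 1) r.ρ (2 * (L : ℝ) ^ 2 * b)).toReal ≤
        (∫⁻ U : GaugeConfig 4 L G, ENNReal.ofReal (Real.exp (-b * wilsonAction r.ρ U) *
            ∏ p : Plaquette 4 L, (if (r.N : ℝ) - WilsonRP.plaqRe r.ρ U p ≤ ε then (1 : ℝ) else 0))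
          ∂(Measure.pi fun _ : Edge 4 L => haarProbability G)).toReal := by
  obtain ⟨C₁, hC₁, hball⟩ := exists_haar_gball_ge r.ρ r.continuous r.injective r.mem_unitary
  obtain ⟨c₁, hc₁, hone⟩ := oneSite_le_two_mul_restricted r
  refine ⟨C₁, 96 + Real.log 2, 16 + c₁, hC₁, by positivity, fun L _ b ε hL hb hc => ?_⟩
  have hb0 : 0 < b := by linarith
  have hL1 : (1 : ℝ) ≤ L := by exact_mod_cast (show 1 ≤ L by omega)
  have hL4 : (1 : ℝ) ≤ (L : ℝ) ^ 4 := one_le_pow₀ hL1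
  have hL2 : (1 : ℝ) ≤ (L : ℝ) ^ 2 := one_le_pow₀ hL1
  -- the Gaussian scale `δ = b^{-1/2}` and the one-site threshold `ε' = (ε − 16δ²)/2`
  set δ : ℝ := b ^ (-(1 / 2 : ℝ)) with hδdef
  have hδ0 : 0 < δ := Real.rpow_pos_of_pos hb0 _
  have hδ1 : δ ≤ 1 := Real.rpow_le_one_of_one_le_of_nonpos hb (by norm_num)
  have hδD : δ ^ dimE r.ρ = b ^ (-((dimE r.ρ : ℝ) / 2)) := by
    rw [hδdef, ← Real.rpow_natCast, ← Real.rpow_mul hb0.le]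
    congr 1
    ring
  have hδ2 : b * δ ^ 2 = 1 := by
    have h2 : δ ^ 2 = b⁻¹ := by
      rw [hδdef, ← Real.rpow_natCast, ← Real.rpow_mul hb0.le, ← Real.rpow_neg_one]
      norm_num
    rw [h2, mul_inv_cancel₀ hb0.ne']
  set ε' : ℝ := (ε - 16 * δ ^ 2) / 2 with hε'def
  have hεε' : 2 * ε' + 16 * δ ^ 2 ≤ ε := by rw [hε'def]; linarith
  -- §3 at `δ`, `ε'`
  have hmaster := restricted_twist_lower_master r L hb0.le hδ0.le hεε'
  -- §4 at temperature `2L²b`: `(2L²b)·ε' = L²·(bε − 16) ≥ c₁`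
  have hs0 : 0 < 2 * (L : ℝ) ^ 2 * b := by positivity
  have htε : c₁ ≤ 2 * (L : ℝ) ^ 2 * b * ε' := by
    have h1 : 2 * (L : ℝ) ^ 2 * b * ε' = (L : ℝ) ^ 2 * (b * ε - 16 * (b * δ ^ 2)) := by rw [hε'def]; ring
    rw [h1, hδ2]
    nlinarith
  have hhalf := hone (2 * (L : ℝ) ^ 2 * b) ε' hs0 htε
  -- finiteness and the real form of the master inequality
  have htop := restrictedPF_ne_top (L := L) r b ε
  have hreal := ENNReal.toReal_mono htop hmaster
  rw [ENNReal.toReal_mul, ENNReal.toReal_mul, ENNReal.toReal_pow, ENNReal.toReal_ofReal (Real.exp_pos _).le] at hreal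
  -- the small-ball bound `C₁ δ^D ≤ Haar{‖r g − 1‖ ≤ δ}`
  have h1 : C₁ * b ^ (-((dimE r.ρ : ℝ) / 2)) ≤ (haarProbability G {g : G | ‖r.ρ g - 1‖ ≤ δ}).toReal := by
    rw [← hδD]
    exact (ENNReal.ofReal_le_iff_le_toReal (measure_ne_top _ _)).1 (hball _ hδ0 hδ1)
  have h0 : 0 ≤ C₁ * b ^ (-((dimE r.ρ : ℝ) / 2)) := (mul_pos hC₁ (Real.rpow_pos_of_pos hb0 _)).le
  -- the prefactor: `e^{−(96 + log 2)L⁴} ≤ ½·e^{−96 b δ² L⁴}`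
  have hexp : Real.exp (-((96 + Real.log 2) * (L : ℝ) ^ 4)) ≤
      Real.exp (-(b * (96 * δ ^ 2 * (L : ℝ) ^ 4))) * (1 / 2) := by
    have hb96 : b * (96 * δ ^ 2 * (L : ℝ) ^ 4) = 96 * (b * δ ^ 2) * (L : ℝ) ^ 4 := by ring
    rw [hb96, hδ2, mul_one, show (1 : ℝ) / 2 = Real.exp (-Real.log 2) by rw [Real.exp_neg, Real.exp_log two_pos]; ring,
      ← Real.exp_add]
    refine Real.exp_le_exp.2 ?_
    have hlog2 : 0 < Real.log 2 := Real.log_pos one_lt_two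
    nlinarith
  calc Real.exp (-((96 + Real.log 2) * (L : ℝ) ^ 4)) * (C₁ * b ^ (-((dimE r.ρ : ℝ) / 2))) ^ (3 * L ^ 4 - 3) *
        (partitionFunction (d := 4) (L := 1) r.ρ (2 * (L : ℝ) ^ 2 * b)).toReal
      ≤ (Real.exp (-(b * (96 * δ ^ 2 * (L : ℝ) ^ 4))) * (1 / 2)) *
          (haarProbability G {g : G | ‖r.ρ g - 1‖ ≤ δ}).toReal ^ (3 * L ^ 4 - 3) *
          (2 * (∫⁻ V : GaugeConfig 4 1 G, ENNReal.ofReal (Real.exp (-(2 * (L : ℝ) ^ 2 * b) * wilsonAction r.ρ V) *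
              ∏ q : Plaquette 4 1, (if (r.N : ℝ) - WilsonRP.plaqRe r.ρ V q ≤ ε' then (1 : ℝ) else 0))
            ∂(Measure.pi fun _ : Edge 4 1 => haarProbability G)).toReal) := by
        gcongr
    _ = Real.exp (-(b * (96 * δ ^ 2 * (L : ℝ) ^ 4))) *
          (haarProbability G {g : G | ‖r.ρ g - 1‖ ≤ δ}).toReal ^ (3 * L ^ 4 - 3) *
          (∫⁻ V : GaugeConfig 4 1 G, ENNReal.ofReal (Real.exp (-(2 * (L : ℝ) ^ 2 * b) * wilsonAction r.ρ V) *
              ∏ q : Plaquette 4 1, (if (r.N : ℝ) - WilsonRP.plaqRe r.ρ V q ≤ ε' then (1 : ℝ) else 0))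
            ∂(Measure.pi fun _ : Edge 4 1 => haarProbability G)).toReal := by ring
    _ ≤ _ := hreal

end Doubling

end Summit.QuantumFields.YangMills.BalabanUVNodes.N20LCSRestrictedDoubling

end
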